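import Literature.AlgebraicGeometry.HodgeTheory.SymmetricA3BraidRelation
import HarnessLib

/-!
# The `A₃` relations = non-commutation ∧ the `B₂` braid relation — all fibre dimensions

Family `hodge`, layer `Literature/AlgebraicGeometry/HodgeTheory`; sequel of `SymmetricA3BraidRelation` (theorems only).  Written by
the prover seat `hodge-nonav-19716-p2` (g9, cell `hodge-nonav`) for the binder hA3 (`SymmetricA3MonodromyRelations`) of crux K1-B
`VeryGeneralSignCommutatorsInHg` (`Summits/HodgeConjecture/HodgeConjecture/Theses/SignSymmetricPowers.lean`, stmt-HodgeConjecture-19716).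

`SymmetricA3BraidRelation` treated odd `n` (transvections, `Nᵢ² = 0`).  For even `n` the Picard–Lefschetz transformations are
REFLECTIONS (`c₀B(δ,δ) = −2`, so `N² = −2N`), and the same dichotomy holds: with `a² = p·a`, `b² = q·b`, `aba = k·a` one has
(`sq_mul_sub_sq_mul_eq_smul_of_sq`)
`((1+a)(1+b))² − ((1+b)(1+a))² = (2 + p + q + k)·((1+a)(1+b) − (1+b)(1+a))`;
for the `A₃`-shaped pair `p = q = c₀B(e₂,e₂) = c₀B(e₁,e₁) ∈ {0, −2}` and `k = (−1)ⁿ I`, and `2 + 2p + (−1)ⁿ I = 0 ⟺ I = 2` in both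
parities.  Hence for EVERY `n ≥ 1`:

* `trans_sq_eq_iff'` — `(T₁T₂)² = (T₂T₁)² ⟺ I = 2 ∨ T₁T₂ = T₂T₁`;
* `symmetricA3MonodromyRelations_iff_nonComm_and_braid'` — given the pair data (from hPL), hA3 ⟺ hN ∧ hBRAID,

so a registry split {hN, hBRAID} of hA3 is parity-free.  (For even `n`, `Tᵢ² = 1` and hBRAID reads `(T₁T₂)⁴ = 1`: the `A₃`
Coxeter element has order `4`.)  Nothing here proves hN or hBRAID; HC not proved; rung F-H1 not moved.

References: [Deligne1980] §4.4 (transvection algebra); [ArnoldGuseinzadeVarchenko2012] AGZV II, Part I §2.9 Thm. 2.15, §5.2;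
[Brieskorn1973] E. Brieskorn, Sém. Bourbaki 401 (π₁ of the regular orbit space = Artin group); [VoisinHodgeII2003] §3.2.1 Thm. 3.16, Rem. 3.21.
-/

noncomputable section

open CategoryTheory AlgebraicGeometry MvPolynomial
open Literature.AlgebraicTopology.SingularHomology
open Literature.AlgebraicGeometry.Motives Literature.AlgebraicGeometry.Motives.UniversalHypersurface

namespace Literature.AlgebraicGeometry.HodgeTheory

/-! ### §1 The ring identity with idempotent-like squares -/

section Algebra

variable {K A : Type*} [Field K] [Ring A] [Algebra K A]

/-- **The braid defect, general squares.**  In any `K`-algebra: if `a² = p·a`, `b² = q·b` and `aba = k·a`, then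
`((1+a)(1+b))² − ((1+b)(1+a))² = (2 + p + q + k)·((1+a)(1+b) − (1+b)(1+a))` (transvections: `p = q = 0`; reflections:
`p = q = −2`). [cite: Deligne1980, §4.4 Lemme (4.4.3^α) p. 227] -/
theorem sq_mul_sub_sq_mul_eq_smul_of_sq (a b : A) (p q k : K) (h1 : a * a = p • a) (h2 : b * b = q • b)
    (h3 : a * b * a = k • a) :
    ((1 + a) * (1 + b)) ^ 2 - ((1 + b) * (1 + a)) ^ 2 =
      (2 + p + q + k) • ((1 + a) * (1 + b) - (1 + b) * (1 + a)) := by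
  have h4 : a * b * a * b = k • (a * b) := by rw [h3, smul_mul_assoc]
  have h5 : b * (a * b * a) = k • (b * a) := by rw [h3, mul_smul_comm]
  have h6 : a * a * b = p • (a * b) := by rw [h1, smul_mul_assoc]
  have h7 : a * (b * b) = q • (a * b) := by rw [h2, mul_smul_comm]
  have h8 : b * b * a = q • (b * a) := by rw [h2, smul_mul_assoc]
  have h9 : b * (a * a) = p • (b * a) := by rw [h1, mul_smul_comm]
  have E1 : ((1 + a) * (1 + b)) ^ 2 = 1 + a + a + b + b + a * b + a * b + a * b + b * a + a * a + b * b
      + a * a * b + a * (b * b) + b * a * b + a * b * a + a * b * a * b := by noncomm_ring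
  have E2 : ((1 + b) * (1 + a)) ^ 2 = 1 + a + a + b + b + b * a + b * a + b * a + a * b + a * a + b * b
      + b * b * a + b * (a * a) + a * b * a + b * a * b + b * (a * b * a) := by noncomm_ring
  have E3 : (1 + a) * (1 + b) - (1 + b) * (1 + a) = a * b - b * a := by noncomm_ring
  rw [E1, E2, E3, h4, h5, h6, h7, h8, h9, h3]
  simp only [add_smul, smul_sub, two_smul]
  abel

end Algebra

/-! ### §2 The braid relation for the `A₃`-shaped pair, any `n` -/

section HodgeTheory

variable {n d : ℕ} {hn : 1 ≤ n} {hd : 1 ≤ d} {hU : IsCohomologicallyLocallyTrivialOn (family ℂ n d) Set.univ}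
  {t₀ : ComplexPoints (base ℂ n d)} {γ₁ γ₂ : Path t₀ t₀} {c₀ : ℚ}
  {e₁ e₂ e₃ : bettiCohomology (fiberOver (family ℂ n d) t₀) n}
  {T₁ T₂ : bettiCohomology (fiberOver (family ℂ n d) t₀) n ≃ₗ[ℚ] bettiCohomology (fiberOver (family ℂ n d) t₀) n}

/-- **Braid defect of the `A₃` pair, all parities.**  For Picard–Lefschetz data `(![e₂]; c₀)` along `γ₁` and `(![e₁, e₃]; c₀)`
along `γ₂` with THE transports `T₁, T₂`: in `End(Hⁿ)`,
`(T₁T₂)² − (T₂T₁)² = (2 + 2p + (−1)ⁿ I)·(T₁T₂ − T₂T₁)` with `p = c₀B(e₂,e₂)` (`= 0` for odd `n`, `= −2` for even `n`) and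
`I = (c₀B(e₁,e₂))² + (c₀B(e₃,e₂))²`. [cite: Deligne1980, §4.4 Lemme (4.4.3^α) p. 227]
[cite: VoisinHodgeII2003, §3.2.1 Thm. 3.16, Cor. 3.17 and Rem. 3.21] -/
theorem sq_trans_sub_sq_trans_eq_smul' (h1 : IsPicardLefschetzData n d 1 hn hd hU γ₁ ![e₂] c₀)
    (h2 : IsPicardLefschetzData n d 2 hn hd hU γ₂ ![e₁, e₃] c₀)
    (hT₁ : IsRatTransport (family ℂ n d) n hU (loopClassUniv n d γ₁) T₁)
    (hT₂ : IsRatTransport (family ℂ n d) n hU (loopClassUniv n d γ₂) T₂) :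
    (((T₂.trans T₁).trans (T₂.trans T₁) : bettiCohomology (fiberOver (family ℂ n d) t₀) n →ₗ[ℚ]
        bettiCohomology (fiberOver (family ℂ n d) t₀) n)) - ((T₁.trans T₂).trans (T₁.trans T₂) : _ →ₗ[ℚ] _) =
      (2 + 2 * (c₀ * BettiUniverse.tr ((isSmoothProjectiveFamily_family ℂ hn hd).isSmoothProjective t₀) (n + n)
              (BettiUniverse.cup (fiberOver (family ℂ n d) t₀) n n e₂ e₂)) +
          (-1 : ℚ) ^ n * ((c₀ * BettiUniverse.tr ((isSmoothProjectiveFamily_family ℂ hn hd).isSmoothProjective t₀) (n + n)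
              (BettiUniverse.cup (fiberOver (family ℂ n d) t₀) n n e₁ e₂)) ^ 2 +
            (c₀ * BettiUniverse.tr ((isSmoothProjectiveFamily_family ℂ hn hd).isSmoothProjective t₀) (n + n)
              (BettiUniverse.cup (fiberOver (family ℂ n d) t₀) n n e₃ e₂)) ^ 2)) •
        (((T₂.trans T₁ : _ ≃ₗ[ℚ] _) : _ →ₗ[ℚ] _) - ((T₁.trans T₂ : _ ≃ₗ[ℚ] _) : _ →ₗ[ℚ] _)) := by
  obtain ⟨T₁', hT₁', hT₁x⟩ := h1.2.2.1
  obtain ⟨T₂', hT₂', hT₂x⟩ := h2.2.2.1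
  have e1 : T₁' = T₁ := isRatTransport_unique_family hT₁' hT₁
  have e2 : T₂' = T₂ := isRatTransport_unique_family hT₂' hT₂
  rw [e1] at hT₁x
  rw [e2] at hT₂x
  set hX : IsSmoothProjective n (fiberOver (family ℂ n d) t₀) :=
    (isSmoothProjectiveFamily_family ℂ hn hd).isSmoothProjective t₀ with hXdef
  set Bl : bettiCohomology (fiberOver (family ℂ n d) t₀) n →ₗ[ℚ]
      bettiCohomology (fiberOver (family ℂ n d) t₀) n →ₗ[ℚ] ℚ :=
    (BettiUniverse.cup (fiberOver (family ℂ n d) t₀) n n).compr₂ (BettiUniverse.tr hX (n + n)) with hBl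
  have hε : ∀ x y, Bl x y = (-1 : ℚ) ^ n * Bl y x := fun x y => tr_cup_comm hX x y
  set a : Module.End ℚ (bettiCohomology (fiberOver (family ℂ n d) t₀) n) :=
    (T₁ : _ →ₗ[ℚ] _) - 1 with hadef
  set b : Module.End ℚ (bettiCohomology (fiberOver (family ℂ n d) t₀) n) :=
    (T₂ : _ →ₗ[ℚ] _) - 1 with hbdef
  have ha : ∀ x, a x = (c₀ * Bl x e₂) • e₂ := fun x => by
    change T₁ x - x = _
    rw [hT₁x x, Fin.sum_univ_one, Matrix.cons_val_zero, smul_smul, add_sub_cancel_left]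
    rfl
  have hb : ∀ x, b x = (c₀ * Bl x e₁) • e₁ + (c₀ * Bl x e₃) • e₃ := fun x => by
    change T₂ x - x = _
    rw [hT₂x x, Fin.sum_univ_two, Matrix.cons_val_zero, Matrix.cons_val_one, Matrix.cons_val_zero, smul_add,
      smul_smul, smul_smul, add_sub_cancel_left]
    rfl
  -- norms (equal for the pair) and orthogonality
  have hnorm : Bl e₁ e₁ = Bl e₃ e₃ ∧ Bl e₁ e₁ = Bl e₂ e₂ := by
    rcases Nat.even_or_odd n with hev | hod
    · have g0 := (h2.even hev 0).1
      have g1 := (h2.even hev 1).1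
      have g2 := (h1.even hev 0).1
      simp only [Matrix.cons_val_zero, Matrix.cons_val_one] at g0 g1 g2
      exact ⟨mul_left_cancel₀ h2.c_ne_zero (g0.trans g1.symm), mul_left_cancel₀ h2.c_ne_zero (g0.trans g2.symm)⟩
    · have g0 := h2.odd hod 0
      have g1 := h2.odd hod 1
      have g2 := h1.odd hod 0
      simp only [Matrix.cons_val_zero, Matrix.cons_val_one] at g0 g1 g2
      exact ⟨g0.trans g1.symm, g0.trans g2.symm⟩
  have h13 : Bl e₁ e₃ = 0 := by
    have := h2.orthogonal (show (0 : Fin 2) ≠ 1 by decide)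
    simp only [Matrix.cons_val_zero, Matrix.cons_val_one] at this
    exact this
  have h31 : Bl e₃ e₁ = 0 := by rw [hε, h13, mul_zero]
  have haa : a * a = (c₀ * Bl e₂ e₂) • a := by
    ext x
    rw [Module.End.mul_apply, ha, ha, LinearMap.smul_apply, ha, map_smul, LinearMap.smul_apply, smul_eq_mul,
      smul_smul]
    congr 1
    ring
  have hbb : b * b = (c₀ * Bl e₂ e₂) • b := by
    ext x
    rw [Module.End.mul_apply, hb, hb x, LinearMap.smul_apply, hb x]
    simp only [map_add, map_smul, LinearMap.add_apply, LinearMap.smul_apply, smul_eq_mul, h13, h31, mul_zero,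
      add_zero, zero_add, smul_add, smul_smul, ← hnorm.2, ← hnorm.1]
    congr 1 <;> (congr 1; ring)
  have haba : a * b * a = ((-1 : ℚ) ^ n * ((c₀ * Bl e₁ e₂) ^ 2 + (c₀ * Bl e₃ e₂) ^ 2)) • a := by
    ext x
    rw [Module.End.mul_apply, Module.End.mul_apply, LinearMap.smul_apply]
    exact apply_rel_of_formulas Bl hε ha hb x
  have hid := sq_mul_sub_sq_mul_eq_smul_of_sq a b _ _ _ haa hbb haba
  have h1a : (1 : Module.End ℚ _) + a = (T₁ : _ →ₗ[ℚ] _) := by rw [hadef]; abel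
  have h1b : (1 : Module.End ℚ _) + b = (T₂ : _ →ₗ[ℚ] _) := by rw [hbdef]; abel
  rw [h1a, h1b] at hid
  have htr : ∀ (P Q : bettiCohomology (fiberOver (family ℂ n d) t₀) n ≃ₗ[ℚ]
      bettiCohomology (fiberOver (family ℂ n d) t₀) n), ((P.trans Q : _ ≃ₗ[ℚ] _) : _ →ₗ[ℚ] _) =
        (Q : Module.End ℚ (bettiCohomology (fiberOver (family ℂ n d) t₀) n)) *
          (P : Module.End ℚ (bettiCohomology (fiberOver (family ℂ n d) t₀) n)) :=
    fun P Q => rfl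
  rw [htr, htr, htr, htr, ← sq, ← sq, hid]
  congr 1
  simp only [hBl, LinearMap.compr₂_apply]
  ring

/-- `2 + 2p + (−1)ⁿ I = 0 ⟺ I = 2` for the normalisations of Picard–Lefschetz data (`p = c₀B(e₂,e₂) = 0` if `n` is odd,
`= −2` if `n` is even). [cite: VoisinHodgeII2003, §3.2.1 Cor. 3.17 and Rem. 3.21] -/
theorem braidScalar_eq_zero_iff (h1 : IsPicardLefschetzData n d 1 hn hd hU γ₁ ![e₂] c₀) (I : ℚ) :
    2 + 2 * (c₀ * BettiUniverse.tr ((isSmoothProjectiveFamily_family ℂ hn hd).isSmoothProjective t₀) (n + n)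
        (BettiUniverse.cup (fiberOver (family ℂ n d) t₀) n n e₂ e₂)) + (-1 : ℚ) ^ n * I = 0 ↔ I = 2 := by
  rcases Nat.even_or_odd n with hev | hod
  · have g := (h1.even hev 0).1
    simp only [Matrix.cons_val_zero] at g
    rw [g, hev.neg_one_pow]
    constructor <;> intro h <;> linarith
  · have g := h1.odd hod 0
    simp only [Matrix.cons_val_zero] at g
    rw [g, hod.neg_one_pow]
    constructor <;> intro h <;> linarith

/-- **The `B₂` braid relation ⟺ (`I = 2` or commutation)**, all parities. [cite: Deligne1980, §4.4 Lemme (4.4.3^α) p. 227]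
[cite: VoisinHodgeII2003, §3.1.2 and §3.2.1 Thm. 3.16] -/
theorem trans_sq_eq_iff' (h1 : IsPicardLefschetzData n d 1 hn hd hU γ₁ ![e₂] c₀)
    (h2 : IsPicardLefschetzData n d 2 hn hd hU γ₂ ![e₁, e₃] c₀)
    (hT₁ : IsRatTransport (family ℂ n d) n hU (loopClassUniv n d γ₁) T₁)
    (hT₂ : IsRatTransport (family ℂ n d) n hU (loopClassUniv n d γ₂) T₂) :
    (T₁.trans T₂).trans (T₁.trans T₂) = (T₂.trans T₁).trans (T₂.trans T₁) ↔
      ((c₀ * BettiUniverse.tr ((isSmoothProjectiveFamily_family ℂ hn hd).isSmoothProjective t₀) (n + n)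
              (BettiUniverse.cup (fiberOver (family ℂ n d) t₀) n n e₁ e₂)) ^ 2 +
            (c₀ * BettiUniverse.tr ((isSmoothProjectiveFamily_family ℂ hn hd).isSmoothProjective t₀) (n + n)
              (BettiUniverse.cup (fiberOver (family ℂ n d) t₀) n n e₃ e₂)) ^ 2 = 2 ∨
        T₁.trans T₂ = T₂.trans T₁) := by
  have hid := sq_trans_sub_sq_trans_eq_smul' h1 h2 hT₁ hT₂
  have hsc := braidScalar_eq_zero_iff h1
    ((c₀ * BettiUniverse.tr ((isSmoothProjectiveFamily_family ℂ hn hd).isSmoothProjective t₀) (n + n)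
        (BettiUniverse.cup (fiberOver (family ℂ n d) t₀) n n e₁ e₂)) ^ 2 +
      (c₀ * BettiUniverse.tr ((isSmoothProjectiveFamily_family ℂ hn hd).isSmoothProjective t₀) (n + n)
        (BettiUniverse.cup (fiberOver (family ℂ n d) t₀) n n e₃ e₂)) ^ 2)
  constructor
  · intro hbr
    have h0 : (((T₂.trans T₁).trans (T₂.trans T₁) : _ ≃ₗ[ℚ] _) : bettiCohomology (fiberOver (family ℂ n d) t₀) n →ₗ[ℚ]
        bettiCohomology (fiberOver (family ℂ n d) t₀) n) - ((T₁.trans T₂).trans (T₁.trans T₂) : _ →ₗ[ℚ] _) = 0 := by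
      rw [hbr, sub_self]
    rw [h0] at hid
    rcases smul_eq_zero.1 hid.symm with h | h
    · exact Or.inl (hsc.1 h)
    · right
      exact (LinearEquiv.toLinearMap_injective (sub_eq_zero.1 h)).symm
  · rintro (h | h)
    · apply LinearEquiv.toLinearMap_injective
      have : (((T₂.trans T₁).trans (T₂.trans T₁) : _ ≃ₗ[ℚ] _) : bettiCohomology (fiberOver (family ℂ n d) t₀) n →ₗ[ℚ]
          bettiCohomology (fiberOver (family ℂ n d) t₀) n) - ((T₁.trans T₂).trans (T₁.trans T₂) : _ →ₗ[ℚ] _) = 0 := by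
        rw [hid, hsc.2 h, zero_smul]
      exact (sub_eq_zero.1 this).symm
    · rw [h]

/-! ### §3 hA3 ⟺ hN ∧ hBRAID, every `n` -/

variable {f₁ g₀ g₂ : MvPolynomial (Fin (n + 2)) ℂ} {ψ : ℂ → ℂ} {εa : ℝ}

/-- **hA3 = hN ∧ hBRAID, all fibre dimensions.**  Given the Picard–Lefschetz pair data on the radius `εa`, the `A₃` operator
relations `SymmetricA3MonodromyRelations` hold iff for THE transports along the two circles: (N) `T₁T₂ ≠ T₂T₁` and (BRAID)
`(T₁T₂)² = (T₂T₁)²` (image of the `B₂` Artin relation of the bifurcation-curve complement).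
[cite: Brieskorn1973, §1 (π₁ of the complement of the discriminant = Artin group; type B₂)]
[cite: ArnoldGuseinzadeVarchenko2012, Part I §5.2 and §2.9 Thm. 2.15] [cite: Deligne1980, §4.4 Lemme (4.4.3^α) p. 227] -/
theorem symmetricA3MonodromyRelations_iff_nonComm_and_braid' (hn : 1 ≤ n) (hd : 1 ≤ d)
    (hP : SymmetricA3PicardLefschetzPair n d f₁ g₀ g₂ ψ εa) :
    SymmetricA3MonodromyRelations n d f₁ g₀ g₂ ψ εa ↔
      ∀ (hU : IsCohomologicallyLocallyTrivialOn (family ℂ n d) Set.univ)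
        (a' : ℂ), ‖a'‖ < εa → a' ≠ 0 →
        ∀ (t₀ : ComplexPoints (base ℂ n d)),
          pointForm ℂ n d t₀ = f₁ + a' • g₂ + (ψ a' / 2) • g₀ →
          ∀ (γ₁ γ₂ : Path t₀ t₀),
            (∀ θ : unitInterval, pointForm ℂ n d (γ₁ θ) =
              f₁ + a' • g₂ + (ψ a' / 2 * Complex.exp (2 * Real.pi * Complex.I * ((θ : ℝ) : ℂ))) • g₀) →
            (∀ θ : unitInterval, pointForm ℂ n d (γ₂ θ) =
              f₁ + a' • g₂ +
                (ψ a' - ψ a' / 2 * Complex.exp (2 * Real.pi * Complex.I * ((θ : ℝ) : ℂ))) • g₀) →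
            ∀ (T₁ T₂ : bettiCohomology (fiberOver (family ℂ n d) t₀) n ≃ₗ[ℚ]
                bettiCohomology (fiberOver (family ℂ n d) t₀) n),
              IsRatTransport (family ℂ n d) n hU (loopClassUniv n d γ₁) T₁ →
              IsRatTransport (family ℂ n d) n hU (loopClassUniv n d γ₂) T₂ →
                T₁.trans T₂ ≠ T₂.trans T₁ ∧ (T₁.trans T₂).trans (T₁.trans T₂) = (T₂.trans T₁).trans (T₂.trans T₁) := by
  constructor
  · intro hR hU a' ha ha0 t₀ ht₀ γ₁ γ₂ hγ₁ hγ₂ T₁ T₂ hT₁ hT₂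
    obtain ⟨hN, hrel⟩ := hR hU a' ha ha0 t₀ ht₀ γ₁ γ₂ hγ₁ hγ₂ T₁ T₂ hT₁ hT₂
    obtain ⟨c₀, e₁, e₂, e₃, h1, h2⟩ := hP hn hd hU a' ha ha0 t₀ ht₀ γ₁ γ₂ hγ₁ hγ₂
    refine ⟨hN, (trans_sq_eq_iff' h1 h2 hT₁ hT₂).2 (Or.inl ?_)⟩
    obtain ⟨T₁', hT₁', hT₁x⟩ := h1.2.2.1
    obtain ⟨T₂', hT₂', hT₂x⟩ := h2.2.2.1
    have e1 : T₁' = T₁ := isRatTransport_unique_family hT₁' hT₁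
    have e2 : T₂' = T₂ := isRatTransport_unique_family hT₂' hT₂
    rw [e1] at hT₁x
    rw [e2] at hT₂x
    set hX : IsSmoothProjective n (fiberOver (family ℂ n d) t₀) :=
      (isSmoothProjectiveFamily_family ℂ hn hd).isSmoothProjective t₀ with hXdef
    set Bl : bettiCohomology (fiberOver (family ℂ n d) t₀) n →ₗ[ℚ]
        bettiCohomology (fiberOver (family ℂ n d) t₀) n →ₗ[ℚ] ℚ :=
      (BettiUniverse.cup (fiberOver (family ℂ n d) t₀) n n).compr₂ (BettiUniverse.tr hX (n + n)) with hBl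
    have hε : ∀ x y, Bl x y = (-1 : ℚ) ^ n * Bl y x := fun x y => tr_cup_comm hX x y
    have hε2 : ((-1 : ℚ) ^ n) ^ 2 = 1 := by
      rcases neg_one_pow_eq_or ℚ n with h' | h' <;> rw [h'] <;> norm_num
    have hN₁ : ∀ x, T₁ x - x = (c₀ * Bl x e₂) • e₂ := fun x => by
      rw [hT₁x x, Fin.sum_univ_one, Matrix.cons_val_zero, smul_smul, add_sub_cancel_left]
      rfl
    have hN₂ : ∀ x, T₂ x - x = (c₀ * Bl x e₁) • e₁ + (c₀ * Bl x e₃) • e₃ := fun x => by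
      rw [hT₂x x, Fin.sum_univ_two, Matrix.cons_val_zero, Matrix.cons_val_one, Matrix.cons_val_zero, smul_add,
        smul_smul, smul_smul, add_sub_cancel_left]
      rfl
    have hrel' : ∀ x, (fun x => T₁ x - x) ((fun x => T₂ x - x) ((fun x => T₁ x - x) x)) =
        ((-1 : ℚ) ^ n * 2) • (fun x => T₁ x - x) x := fun x => hrel x
    have hne : ∃ x, (fun x => T₁ x - x) x ≠ 0 := by
      by_contra h0
      push Not at h0
      apply hN
      have hT1 : T₁ = LinearEquiv.refl ℚ _ := LinearEquiv.ext fun x => by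
        have := h0 x; rw [sub_eq_zero] at this; simpa using this
      rw [hT1]; rfl
    exact sum_sq_eq_two_of_rel Bl hε hε2 hN₁ hN₂ hrel' hne
  · intro hB hU a' ha ha0 t₀ ht₀ γ₁ γ₂ hγ₁ hγ₂ T₁ T₂ hT₁ hT₂
    obtain ⟨hN, hbr⟩ := hB hU a' ha ha0 t₀ ht₀ γ₁ γ₂ hγ₁ hγ₂ T₁ T₂ hT₁ hT₂
    obtain ⟨c₀, e₁, e₂, e₃, h1, h2⟩ := hP hn hd hU a' ha ha0 t₀ ht₀ γ₁ γ₂ hγ₁ hγ₂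
    refine ⟨hN, fun x => ?_⟩
    have hI := ((trans_sq_eq_iff' h1 h2 hT₁ hT₂).1 hbr).resolve_right hN
    obtain ⟨T₁', hT₁', hT₁x⟩ := h1.2.2.1
    obtain ⟨T₂', hT₂', hT₂x⟩ := h2.2.2.1
    have e1 : T₁' = T₁ := isRatTransport_unique_family hT₁' hT₁
    have e2 : T₂' = T₂ := isRatTransport_unique_family hT₂' hT₂
    rw [e1] at hT₁x
    rw [e2] at hT₂x
    set hX : IsSmoothProjective n (fiberOver (family ℂ n d) t₀) :=
      (isSmoothProjectiveFamily_family ℂ hn hd).isSmoothProjective t₀ with hXdef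
    set Bl : bettiCohomology (fiberOver (family ℂ n d) t₀) n →ₗ[ℚ]
        bettiCohomology (fiberOver (family ℂ n d) t₀) n →ₗ[ℚ] ℚ :=
      (BettiUniverse.cup (fiberOver (family ℂ n d) t₀) n n).compr₂ (BettiUniverse.tr hX (n + n)) with hBl
    have hε : ∀ x y, Bl x y = (-1 : ℚ) ^ n * Bl y x := fun x y => tr_cup_comm hX x y
    have hN₁ : ∀ x, T₁ x - x = (c₀ * Bl x e₂) • e₂ := fun x => by
      rw [hT₁x x, Fin.sum_univ_one, Matrix.cons_val_zero, smul_smul, add_sub_cancel_left]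
      rfl
    have hN₂ : ∀ x, T₂ x - x = (c₀ * Bl x e₁) • e₁ + (c₀ * Bl x e₃) • e₃ := fun x => by
      rw [hT₂x x, Fin.sum_univ_two, Matrix.cons_val_zero, Matrix.cons_val_one, Matrix.cons_val_zero, smul_add,
        smul_smul, smul_smul, add_sub_cancel_left]
      rfl
    have h := apply_rel_of_formulas Bl hε hN₁ hN₂ x
    have hI' : (c₀ * Bl e₁ e₂) ^ 2 + (c₀ * Bl e₃ e₂) ^ 2 = 2 := hI
    rw [hI'] at h
    simpa only using h

end HodgeTheory

end Literature.AlgebraicGeometry.HodgeTheory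

end
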